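import Summits.BirchSwinnertonDyer.BirchSwinnertonDyer.Theorems.TwoAdicConverseOrdLambdaHalfAtTwoGreenbergWbarDescent
import Summits.BirchSwinnertonDyer.BirchSwinnertonDyer.Theorems.EisensteinPrimesTwoVariableSelmerControl
import Summits.BirchSwinnertonDyer.BirchSwinnertonDyer.Theorems.ResidualThetaTransportAtTwoUnramifiedRestriction
import Literature.NumberTheory.EllipticCurves.SubgroupSelmerCocycleCriteriaProofs
import Literature.GroupTheory.PadicQuotientSectionProofs
import HarnessLib

/-!
# Route `TwoAdicConverse` (rung S3), crux `OrdLambdaHalfAtTwo` (item stmt-BirchSwinnertonDyer-19556), line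
# `kato-determinant-greenberg-two`: the `w̄`-step [C] REDUCED to its finite-layer form — descent WITH splitting at `w` (brick C0-b)

Cell `bsd-2adic`, seat `bsd-2adic-conv-1` GEN 25 (`--supports` stmt-BirchSwinnertonDyer-19556 `--as helper`; pen RC-318 (c); design memo
NOTE-19556-GL1res-conv1-g25-ADDENDUM-1 §C, step C0).  The registered stub `stub_wbarStepAtTwo` (v3.2) speaks of a class `c` of
`H¹(Gal(K̄/K_∞), M)` unramified away from `p` and STRICT at `w` (zero on every decomposition group above `w`).  Its classical proof
(NOTE §1 (a)) first descends `c` to a finite layer `K_n` AS A CLASS SPLIT AT `w_n` — the Galois-theoretic step «`F'_n := F^{D_w}`» — and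
only then invokes class field theory over `K_n`.  This file proves that first step in the kernel, for ANY number field `K`, ANY
`ℤ_p`-extension `κ` (topological generator `γ`), ANY finite discrete `Γ_K`-module `M` of `p`-power order with trivial action and ANY
place `w` that is UNDECOMPOSED in `K_∞` (`κ(D_w) = ℤ_p`; for the line: `w ∣ 2` totally ramified in the cyclotomic tower):

* `zero_on_inf_decomp_of_mem_strictKer_bdpData` — strict at `w` for Castella's datum ⟹ the class dies on `ker κ ⊓ D_w`
  (`awayKer`; the coefficient map `M → M ⧸ 0` is injective);
* **`exists_layer_lift_mem_awayKer`** — DESCENT WITH SPLITTING: a class `c ∈ H¹(ker κ, M)` dying on `ker κ ⊓ D_w` is `res` of a class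
  `c'' ∈ H¹(Gal(K̄/K_n), M)` (some `n`) that dies on `Gal(K̄/K_n) ⊓ D_w`.  Proof: descend `c` to some `c'` (`exists_layer_resOfLe_eq_of_trivial`,
  C0-a); split `κ` continuously INSIDE `D_w` (`Literature.GroupTheory.exists_continuousMonoidHom_section_padicInt` applied to `κ|_{D_w}`,
  surjective since `w` is undecomposed) to get a retraction `r = s ∘ κ : Gal(K̄/K_n) → Gal(K̄/K_n) ∩ D_w` with kernel `ker κ`; subtract the
  pull-back `θ = r^* c'`: `θ` dies on `ker κ`, and `c' − θ` dies on `Gal(K̄/K_n) ⊓ D_w` because every `d` there is `(d·r(d)⁻¹)·r(d)` with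
  `d·r(d)⁻¹ ∈ ker κ ⊓ D_w`, where `c` vanishes (cocycles with trivial coefficients are homomorphisms);
* **`wbarStep_of_layerwise`** — hence the registered stub's statement FOLLOWS from its FINITE-LAYER form [C_fin]: «for every `n` and every
  class of `H¹(Gal(K̄/K_n), M)` unramified at all places prime to `p` and dying on `Gal(K̄/K_n) ⊓ D_w`, its restriction to `K_∞` is unramified
  at the (chosen) places above `p`» — the statement a class-field-theoretic treatment of the layer fields `K_n` (ray class characters;
  the tree's `exists_isGlobalReciprocityMap`, `KroneckerWeber_holds`) would deliver (ADDENDUM-1 steps C1–C4).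

HONEST FRAMING.  Composition of tree theorems + cocycle arithmetic; no definition, no named fact, no `sorry`; [C_fin] is a displayed
hypothesis; `stub_wbarStepAtTwo` stays a registered stub (the lead closes stubs, RC-317); BSD is not proved by any of this.
PARTITION (D-0054): none — RANK axis S3 × X5@2 stratum (β); types-the-object-of.

References: R. Greenberg, LNM 1716 (1999) §3 Lemma 3.2 [GreenbergLNM1716]; J.-P. Serre, *Galois Cohomology* I §2, I §1.4 [SerreGaloisCohomology1997];
Neukirch–Schmidt–Wingberg (1.6.4), (1.6.7) [NeukirchSchmidtWingberg2008].
-/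

set_option linter.dupNamespace false
set_option autoImplicit false

noncomputable section

open scoped Classical

namespace Summit.BirchSwinnertonDyer.BirchSwinnertonDyer.Theorems.TwoAdicGreenbergCotorsion

open NumberField IsDedekindDomain Field
open Literature.NumberTheory.EllipticCurves Literature.NumberTheory.EllipticCurves.GreenbergSelmer
  Literature.NumberTheory.EllipticCurves.GreenbergVatsal2000 Literature.NumberTheory.GaloisRepresentations
  Summit.BirchSwinnertonDyer.Rank1Residual.X11b Summit.BirchSwinnertonDyer.Rank1Residual.X11b.AcSelmer
  Summit.BirchSwinnertonDyer.BirchSwinnertonDyer.Theorems.IwasawaTwoVariable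
  Summit.BirchSwinnertonDyer.BirchSwinnertonDyer.Theorems.ResidualLayer
  Literature.NumberTheory.EllipticCurves.CocycleCriteria

variable {K : Type} [Field K] [NumberField K] {p : ℕ} [Fact p.Prime] (κ : ZpExtension K p)
  (M : Type) [AddCommGroup M] [DistribMulAction (absoluteGaloisGroup K) M] [TopologicalSpace M] [DiscreteTopology M]

/-! ## §1 Cocycles with trivial coefficients are homomorphisms -/

section Trivial

variable {M} {H : Subgroup (absoluteGaloisGroup K)}

omit [NumberField K] in
/-- A continuous `1`-cocycle of a subgroup `H ≤ Γ_K` with values in a module on which `Γ_K` acts trivially is additive. [folklore] -/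
theorem cocycle_mul_of_trivial (htriv : ∀ (σ : absoluteGaloisGroup K) (m : M), σ • m = m)
    (z : contOneCocycles (discreteTopRep H M)) (g h : H) : z.1 (g * h) = z.1 g + z.1 h := by
  have e := z.2 g h
  change z.1 (g * h) = z.1 g + (g : absoluteGaloisGroup K) • z.1 h at e
  rw [htriv] at e
  exact e

omit [NumberField K] in
/-- … hence vanishes at `1`. [folklore] -/
theorem cocycle_one_of_trivial (htriv : ∀ (σ : absoluteGaloisGroup K) (m : M), σ • m = m)
    (z : contOneCocycles (discreteTopRep H M)) : z.1 1 = 0 := by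
  have e := cocycle_mul_of_trivial htriv z 1 1
  rw [mul_one] at e
  exact left_eq_add.mp e

omit [NumberField K] in
/-- … and satisfies `z(g h⁻¹) = z g − z h`. [folklore] -/
theorem cocycle_mul_inv_of_trivial (htriv : ∀ (σ : absoluteGaloisGroup K) (m : M), σ • m = m)
    (z : contOneCocycles (discreteTopRep H M)) (g h : H) : z.1 (g * h⁻¹) = z.1 g - z.1 h := by
  have e := cocycle_mul_of_trivial htriv z (g * h⁻¹) h
  rw [inv_mul_cancel_right] at e
  rw [e, add_sub_cancel_right]

omit [NumberField K] in
/-- With trivial coefficients a class restricted to a subgroup vanishes iff a (any) representing cocycle vanishes there pointwise.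
[folklore] -/
theorem resOfLe_oneCocycleClass_eq_zero_iff_of_trivial (htriv : ∀ (σ : absoluteGaloisGroup K) (m : M), σ • m = m)
    {H₁ : Subgroup (absoluteGaloisGroup K)} (hle : H₁ ≤ H) (z : contOneCocycles (discreteTopRep H M)) :
    resOfLe M hle (oneCocycleClass _ z) = 0 ↔ ∀ x : H₁, z.1 (Subgroup.inclusion hle x) = 0 := by
  rw [resOfLe_oneCocycleClass_eq_zero_iff]
  constructor
  · rintro ⟨a, ha⟩ x
    rw [ha x, htriv, sub_self]
  · intro h
    exact ⟨0, fun x ↦ by rw [h x, smul_zero, sub_self]⟩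

end Trivial

/-! ## §2 Strict at `w` (Castella's datum) ⟹ the class dies on `ker κ ⊓ D_w` -/

/-- For Castella's data `bdpData M p w` (strict datum `M⁺_w = 0` at `w`): a class in the strict kernel at `w` dies on `H ⊓ D_w`
(`awayKer`), since `M → M ⧸ 0` is injective (trivial action suffices for the bookkeeping here).
[cite: Greenberg1989, §1 p. 98] [cite: Castella2018, Def. 2.2 (arXiv:1704.06608 p. 5)] -/
theorem mem_awayKer_of_mem_strictKer_bdpData {p : ℕ} (H : Subgroup (absoluteGaloisGroup K)) [H.Normal]
    (htriv : ∀ (σ : absoluteGaloisGroup K) (m : M), σ • m = m)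
    {w : HeightOneSpectrum (𝓞 K)} (hw : ((p : ℕ) : 𝓞 K) ∈ w.asIdeal) {c : subgroupH1 H M}
    (hc : c ∈ (AcSelmer.bdpData M p w w hw).strictKer H) : c ∈ awayKer H M w := by
  rw [AcSelmer.bdpData_self] at hc
  obtain ⟨z, rfl⟩ := oneCocycleClass_surjective _ c
  rw [LocalDatum.mem_strictKer_iff, LocalDatum.strictMap, resH1Hom_oneCocycleClass_eq_zero_iff] at hc
  obtain ⟨t, ht⟩ := hc
  rw [awayKer, AddMonoidHom.mem_ker, resOfLe_oneCocycleClass_eq_zero_iff_of_trivial htriv]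
  intro x
  obtain ⟨hxH, hxD⟩ := Subgroup.mem_inf.mp x.2
  let y : decompIn H w := ⟨⟨(x : absoluteGaloisGroup K), hxD⟩, (mem_decompIn_iff H w _).2 hxH⟩
  have hy := ht y
  -- the action on `M ⧸ 0` is trivial, so `grMk (z x) = 0`, i.e. `z x ∈ ⊥`
  have hyt : y • t = t := by
    obtain ⟨m, rfl⟩ := (AcSelmer.strictDatum M w).grMk_surjective t
    rw [Subgroup.smul_def, LocalDatum.smul_grMk, htriv]
  rw [hyt, sub_self] at hy
  have hmem : z.1 (decompInToH H w y) ∈ (AcSelmer.strictDatum M w).plus := by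
    rw [← LocalDatum.ker_grMk]; exact hy
  have hzero : z.1 (decompInToH H w y) = 0 := by
    simpa [AcSelmer.strictDatum] using hmem
  have e : decompInToH H w y = Subgroup.inclusion (inf_le_left : H ⊓ decomp w ≤ H) x := Subtype.ext rfl
  rw [← e]; exact hzero

omit [NumberField K] in
/-- `resH1Hom` (identity on coefficients) on an explicit class is the class of the pulled-back cocycle (public form of the tree's
private `resH1Hom_oneCocycleClass_eq`). [folklore] -/
theorem resH1Hom_id_oneCocycleClass_eq {G G' : Subgroup (absoluteGaloisGroup K)} (φ : G' →ₜ* G)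
    (h : ∀ (x : G') (m : M), AddMonoidHom.id M (φ x • m) = x • AddMonoidHom.id M m)
    (f : contOneCocycles (discreteTopRep G M)) :
    resH1Hom φ (AddMonoidHom.id M) h (oneCocycleClass (discreteTopRep G M) f) =
      oneCocycleClass (discreteTopRep G' M) (contOneCocycles.pullback φ (resHomOfEquivariant φ (AddMonoidHom.id M) h) f) :=
  map_oneCocycleClass (X := discreteTopRep G M) (Y := discreteTopRep G' M) φ
    (resHomOfEquivariant φ (AddMonoidHom.id M) h) f

/-! ## §3 Descent with splitting at an undecomposed place -/

/-- **Descent WITH splitting at `w`.**  `κ` a `ℤ_p`-extension with topological generator `γ`, `M` finite of `p`-power order with trivial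
action, `w` a place with `κ(D_w) = ℤ_p` (undecomposed in `K_∞`): a class `c ∈ H¹(ker κ, M)` dying on `ker κ ⊓ D_w` is the restriction of a
class of some layer `H¹(Gal(K̄/K_n), M)` dying on `Gal(K̄/K_n) ⊓ D_w`.  (Descent C0-a, then subtraction of the pull-back along the
retraction `s ∘ κ` onto a continuous section `s` of `κ|_{D_w}` — `exists_continuousMonoidHom_section_padicInt`.)
[cite: GreenbergLNM1716, §3 Lemma 3.2] [cite: NeukirchSchmidtWingberg2008, (1.6.4)] -/
theorem exists_layer_lift_mem_awayKer {γ : absoluteGaloisGroup K} (hγ : κ.IsTopGenerator γ) [Finite M]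
    (hM : ∃ k : ℕ, Nat.card M = p ^ k) (htriv : ∀ (σ : absoluteGaloisGroup K) (m : M), σ • m = m)
    (w : HeightOneSpectrum (𝓞 K)) (hwtot : ∀ z : ℤ_[p], ∃ d ∈ decomp w, κ d = Multiplicative.ofAdd z)
    (c : subgroupH1 κ.kerSubgroup M) (hcw : c ∈ awayKer κ.kerSubgroup M w) :
    ∃ (n : ℕ) (c'' : subgroupH1 (κ.layerSubgroup n) M),
      resOfLe M (κ.kerSubgroup_le_layerSubgroup n) c'' = c ∧ c'' ∈ awayKer (κ.layerSubgroup n) M w := by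
  obtain ⟨n, c', hc'⟩ := exists_layer_resOfLe_eq_of_trivial κ M hγ hM htriv c
  obtain ⟨z, rfl⟩ := oneCocycleClass_surjective _ c'
  -- a continuous section of `κ` inside `D_w`
  let D : Subgroup (absoluteGaloisGroup K) := decomp w
  haveI : CompactSpace D := isCompact_iff_compactSpace.mp (Kobayashi2003.isCompact_decomp w)
  let κD : D →ₜ* Multiplicative ℤ_[p] :=
    κ.toContinuousMonoidHom.comp ⟨D.subtype, continuous_subtype_val⟩
  obtain ⟨d₁, hd₁D, hd₁⟩ := hwtot 1
  obtain ⟨s, hs⟩ := Literature.GroupTheory.exists_continuousMonoidHom_section_padicInt κD ⟨d₁, hd₁D⟩ hd₁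
  have hsκ : ∀ y : Multiplicative ℤ_[p], κ ((s y : D) : absoluteGaloisGroup K) = y := hs
  -- the retraction `r = s ∘ κ` on the layer `Γ_n := κ.layerSubgroup n`
  let Γn : Subgroup (absoluteGaloisGroup K) := κ.layerSubgroup n
  have hr_mem : ∀ x : Γn, ((s (κ (x : absoluteGaloisGroup K)) : D) : absoluteGaloisGroup K) ∈ Γn := fun x ↦ by
    change _ ∈ κ.layerSubgroup n
    rw [ZpExtension.mem_layerSubgroup, hsκ]
    exact ZpExtension.mem_layerSubgroup.mp x.2
  let r : Γn →ₜ* Γn :=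
    { toFun := fun x ↦ ⟨((s (κ (x : absoluteGaloisGroup K)) : D) : absoluteGaloisGroup K), hr_mem x⟩
      map_one' := Subtype.ext (by simp)
      map_mul' := fun x y ↦ Subtype.ext (by simp)
      continuous_toFun := by
        apply Continuous.subtype_mk
        exact continuous_subtype_val.comp (s.continuous_toFun.comp
          (κ.toContinuousMonoidHom.continuous_toFun.comp continuous_subtype_val)) }
  have hr_val : ∀ x : Γn, ((r x : Γn) : absoluteGaloisGroup K) = ((s (κ (x : absoluteGaloisGroup K)) : D) : absoluteGaloisGroup K) :=
    fun _ ↦ rfl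
  have hr_decomp : ∀ x : Γn, ((r x : Γn) : absoluteGaloisGroup K) ∈ decomp w := fun x ↦ (s (κ (x : absoluteGaloisGroup K))).2
  have hr_κ : ∀ x : Γn, κ ((r x : Γn) : absoluteGaloisGroup K) = κ (x : absoluteGaloisGroup K) := fun x ↦ hsκ _
  -- the pull-back `θ = r^* c'` and the corrected lift
  have hcompat : ∀ (x : Γn) (m : M), AddMonoidHom.id M (r x • m) = x • AddMonoidHom.id M m := fun x m ↦ by
    change ((r x : Γn) : absoluteGaloisGroup K) • m = (x : absoluteGaloisGroup K) • m
    rw [htriv, htriv]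
  set θ : subgroupH1 Γn M := resH1Hom r (AddMonoidHom.id M) hcompat (oneCocycleClass _ z) with hθdef
  -- the cocycle `z` vanishes on `ker κ ⊓ D_w` (from `hcw`)
  have hzvan : ∀ (y : absoluteGaloisGroup K) (hyH : y ∈ κ.kerSubgroup), y ∈ decomp w →
      z.1 ⟨y, κ.kerSubgroup_le_layerSubgroup n hyH⟩ = 0 := by
    intro y hyH hyD
    have h0 : resOfLe M (inf_le_left : κ.kerSubgroup ⊓ decomp w ≤ κ.kerSubgroup)
        (resOfLe M (κ.kerSubgroup_le_layerSubgroup n) (oneCocycleClass _ z)) = 0 := by rw [hc']; exact hcw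
    rw [resOfLe, resOfLe, resH1Hom_resH1Hom, resH1Hom_oneCocycleClass_eq_zero_iff] at h0
    obtain ⟨a, ha⟩ := h0
    have hx := ha ⟨y, Subgroup.mem_inf.mpr ⟨hyH, hyD⟩⟩
    rw [Subgroup.smul_def, htriv, sub_self] at hx
    exact hx
  refine ⟨n, oneCocycleClass _ z - θ, ?_, ?_⟩
  · -- `res_{ker κ} θ = 0`: on `ker κ`, `r` is trivial and cocycles vanish at `1`
    rw [map_sub, hc', sub_eq_self, hθdef, resOfLe, resH1Hom_resH1Hom, resH1Hom_oneCocycleClass_eq_zero_iff]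
    refine ⟨0, fun h ↦ ?_⟩
    rw [smul_zero, sub_zero]
    have hrh : r (Subgroup.inclusion (κ.kerSubgroup_le_layerSubgroup n) h) = 1 := by
      apply Subtype.ext
      rw [hr_val]
      have hκh : κ ((Subgroup.inclusion (κ.kerSubgroup_le_layerSubgroup n) h : Γn) : absoluteGaloisGroup K) = 1 := by
        rw [Subgroup.coe_inclusion]; exact ZpExtension.mem_kerSubgroup.mp h.2
      rw [hκh, map_one]; rfl
    change z.1 (r (Subgroup.inclusion (κ.kerSubgroup_le_layerSubgroup n) h)) = 0
    rw [hrh]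
    exact cocycle_one_of_trivial htriv z
  · -- `c' − θ` dies on `Γ_n ⊓ D_w`: its cocycle is `x ↦ z x − z (r x)`
    rw [awayKer, AddMonoidHom.mem_ker, map_sub, hθdef, resH1Hom_id_oneCocycleClass_eq, ← map_sub, ← oneCocycleClass_sub,
      resOfLe_oneCocycleClass_eq_zero_iff_of_trivial htriv]
    intro x
    obtain ⟨hxΓ, hxD⟩ := Subgroup.mem_inf.mp x.2
    set g : Γn := Subgroup.inclusion (inf_le_left : Γn ⊓ decomp w ≤ Γn) x with hg
    change z.1 g - z.1 (r g) = 0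
    -- `g = (g (r g)⁻¹) (r g)` with `g (r g)⁻¹ ∈ ker κ ⊓ D_w`
    have hκy : ((g * (r g)⁻¹ : Γn) : absoluteGaloisGroup K) ∈ κ.kerSubgroup := by
      rw [ZpExtension.mem_kerSubgroup, Subgroup.coe_mul, Subgroup.coe_inv, map_mul, map_inv, hr_κ, mul_inv_cancel]
    have hDy : ((g * (r g)⁻¹ : Γn) : absoluteGaloisGroup K) ∈ decomp w := by
      rw [Subgroup.coe_mul, Subgroup.coe_inv]
      exact (decomp w).mul_mem hxD ((decomp w).inv_mem (hr_decomp g))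
    have hzy : z.1 (g * (r g)⁻¹) = 0 := by
      have h := hzvan _ hκy hDy
      have e : (⟨((g * (r g)⁻¹ : Γn) : absoluteGaloisGroup K), κ.kerSubgroup_le_layerSubgroup n hκy⟩ : Γn) = g * (r g)⁻¹ :=
        Subtype.ext rfl
      rwa [e] at h
    rw [cocycle_mul_inv_of_trivial htriv] at hzy
    exact sub_eq_zero.mp hzy |> fun h ↦ by rw [h, sub_self]

/-! ## §4 The registered `w̄`-step from its finite-layer form -/

/-- **`stub_wbarStepAtTwo`'s statement ⟸ its FINITE-LAYER form [C_fin]** (for ANY number field, ANY `ℤ_p`-extension with a topological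
generator, ANY finite `Γ_K`-module of `p`-power order with trivial action, ANY place `w ∋ p` undecomposed in `K_∞`).  [C_fin] `hfin`: for
every layer `n` and every class `c'` of `H¹(Gal(K̄/K_n), M)` that is unramified at every place prime to `p` (all `Γ_K`-conjugates) and DIES
on `Gal(K̄/K_n) ⊓ D_w` (split at the place of `K_n` below the chosen place above `w`), the restriction of `c'` to `K_∞` is unramified at
every (chosen) place above `p`.  Conclusion: the shape `hC` of `finite_datumStrictSelmer_bdpData_of_inputs` (p661729) = the registered stub.
Proof: conjugate, pass from strict to away (§2), descend with splitting (§3), transfer unramifiedness at `v ∤ p` to the layer (`ℤ_p`-extensions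
are unramified outside `p`: `inertia_le_kerSubgroup_of_not_mem`; `mem_unramifiedKer_of_resOfLe_mem`), apply [C_fin].
[cite: GreenbergLNM1716, §3 Lemma 3.2] [cite: Washington1997, Prop. 13.2] -/
theorem wbarStep_of_layerwise {γ : absoluteGaloisGroup K} (hγ : κ.IsTopGenerator γ) [Finite M]
    (hM : ∃ k : ℕ, Nat.card M = p ^ k) (htriv : ∀ (σ : absoluteGaloisGroup K) (m : M), σ • m = m)
    (w : HeightOneSpectrum (𝓞 K)) (hw : ((p : ℕ) : 𝓞 K) ∈ w.asIdeal)
    (hwtot : ∀ z : ℤ_[p], ∃ d ∈ decomp w, κ d = Multiplicative.ofAdd z)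
    (hfin : ∀ (n : ℕ) (c' : subgroupH1 (κ.layerSubgroup n) M),
      (∀ v : HeightOneSpectrum (𝓞 K), ((p : ℕ) : 𝓞 K) ∉ v.asIdeal →
        ∀ σ : absoluteGaloisGroup K, conjH1 (κ.layerSubgroup n) M σ c' ∈ unramifiedKer (κ.layerSubgroup n) M v) →
      c' ∈ awayKer (κ.layerSubgroup n) M w →
      ∀ v : HeightOneSpectrum (𝓞 K), ((p : ℕ) : 𝓞 K) ∈ v.asIdeal →
        resOfLe M (κ.kerSubgroup_le_layerSubgroup n) c' ∈ unramifiedKer κ.kerSubgroup M v) :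
    ∀ c : subgroupH1 κ.kerSubgroup M, c ∈ unramifiedOutside κ.kerSubgroup M p ∅ →
      (∀ σ : absoluteGaloisGroup K, conjH1 κ.kerSubgroup M σ c ∈ (AcSelmer.bdpData M p w w hw).strictKer κ.kerSubgroup) →
      ∀ (v : HeightOneSpectrum (𝓞 K)), ((p : ℕ) : 𝓞 K) ∈ v.asIdeal →
        ∀ σ : absoluteGaloisGroup K, conjH1 κ.kerSubgroup M σ c ∈ unramifiedKer κ.kerSubgroup M v := by
  intro c hunr hstr v hv σ
  set c₁ := conjH1 κ.kerSubgroup M σ c with hc₁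
  -- `c₁` satisfies the same hypotheses (they are stable under conjugation)
  have hconj : ∀ τ : absoluteGaloisGroup K, conjH1 κ.kerSubgroup M τ c₁ = conjH1 κ.kerSubgroup M (τ * σ) c := fun τ ↦ by
    rw [hc₁, conjH1_mul_holds, AddMonoidHom.comp_apply]
  have h1' : ∀ v' : HeightOneSpectrum (𝓞 K), ((p : ℕ) : 𝓞 K) ∉ v'.asIdeal →
      ∀ τ : absoluteGaloisGroup K, conjH1 κ.kerSubgroup M τ c₁ ∈ unramifiedKer κ.kerSubgroup M v' := fun v' hv' τ ↦ by
    rw [hconj]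
    exact (mem_unramifiedOutside_iff _).1 hunr v' (Set.notMem_empty _) hv' (τ * σ)
  have hcw : c₁ ∈ awayKer κ.kerSubgroup M w := mem_awayKer_of_mem_strictKer_bdpData M κ.kerSubgroup htriv hw (hstr σ)
  -- descent with splitting
  obtain ⟨n, c'', hres, haway⟩ := exists_layer_lift_mem_awayKer κ M hγ hM htriv w hwtot c₁ hcw
  -- the layer class is unramified at the places prime to `p`
  have h1'' : ∀ v' : HeightOneSpectrum (𝓞 K), ((p : ℕ) : 𝓞 K) ∉ v'.asIdeal →
      ∀ τ : absoluteGaloisGroup K, conjH1 (κ.layerSubgroup n) M τ c'' ∈ unramifiedKer (κ.layerSubgroup n) M v' := by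
    intro v' hv' τ
    refine mem_unramifiedKer_of_resOfLe_mem (κ.kerSubgroup_le_layerSubgroup n)
      (fun x hx ↦ inertia_le_kerSubgroup_of_not_mem κ hv' (Subgroup.mem_inf.mp hx).2) ?_
    rw [← AddMonoidHom.comp_apply, resOfLe_comp_conjH1_holds (M := M) (κ.kerSubgroup_le_layerSubgroup n) τ,
      AddMonoidHom.comp_apply, hres]
    exact h1' v' hv' τ
  have h := hfin n c'' h1'' haway v hv
  rwa [hres] at h

end Summit.BirchSwinnertonDyer.BirchSwinnertonDyer.Theorems.TwoAdicGreenbergCotorsion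

end
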